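import Summits.AtomisticToContinuum.Crystallization.Theorems.HolmgrenBoyleLindOpenVanishing

/-!
# Route `HolmgrenBoyleLind`: `UCContinuum` — the provable half of the crux
`HalfSpaceUniqueContinuation`

Support file for item stmt-AtomisticToContinuum-6079 (`FLCEquilibriumPeriodic`), which is
EQUIVALENT to the crux `HalfSpaceUniqueContinuation` (item 6075; `flcEquilibriumPeriodic_iff_uc`).
The Theses docstring (TWO-LAYER PLAN) splits the crux as `UC ⇐ UCContinuum → UCDiscrete`:
`UCContinuum` = «the difference field vanishes on an OPEN subset of the lower half-space ⇒
ω = ω'», `UCDiscrete` = «force balance at the relatively dense common points below the plane ⇒ the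
difference field vanishes on an open set» (the Remez / Logvinenko–Sereda front). This file proves
`UCContinuum` and the formal reduction of the crux to `UCDiscrete`, on top of
`hbl_sources_empty_of_field_eqOn_open` (`HolmgrenBoyleLindOpenVanishing.lean`):

* `hbl_diffField_eq_zero_of_balanced` — bookkeeping: at a common point of two separated sets that
  is in exact force balance in both, the signed field of the symmetric difference vanishes;
* `hbl_eq_of_diffField_eqOn_open` — **`UCContinuum`**: two `δ`-separated sets whose difference
  field vanishes on a non-empty open set off their symmetric difference are EQUAL (no balance,
  density or FLC hypothesis needed);
* `hbl_diffField_eq_zero_on_halfSpace` — for two balanced separated sets agreeing on an open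
  half-space, the difference field vanishes at all their points in that half-space (the input of
  `UCDiscrete`);
* `halfSpaceUniqueContinuation_of_open_vanishing` — **`UCDiscrete → HalfSpaceUniqueContinuation`**.

All `[folklore]`; nothing here closes an item.
-/

noncomputable section

namespace Summit.AtomisticToContinuum.Crystallization.Theorems

open scoped BigOperators Topology InnerProductSpace
open Filter Set
open Literature.MathematicalPhysics.StatisticalMechanics
open Summit.AtomisticToContinuum.Crystallization.Theorems.ExcessDecayLiouville
open Summit.AtomisticToContinuum.Crystallization.Theorems.HolmgrenBoyleLind
open Summit.AtomisticToContinuum.Crystallization.Theses.HolmgrenBoyleLind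

/-! ## Two separated sets: bookkeeping and `UCContinuum` -/

/-- **Bookkeeping.** If `x` is a common point of the `δ`-separated sets `ω, ω'` and is in exact
Lennard-Jones force balance in both, then the signed field of the symmetric difference
(`+` on `ω ∖ ω'`, `−` on `ω' ∖ ω`) vanishes at `x`. [folklore] -/
theorem hbl_diffField_eq_zero_of_balanced {ω ω' : Set (EuclideanSpace ℝ (Fin 3))} {δ : ℝ}
    (hδ : 0 < δ)
    (hsep : ∀ a ∈ ω, ∀ b ∈ ω, a ≠ b → δ ≤ dist a b)
    (hsep' : ∀ a ∈ ω', ∀ b ∈ ω', a ≠ b → δ ≤ dist a b)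
    {x : EuclideanSpace ℝ (Fin 3)} (hx : x ∈ ω) (hx' : x ∈ ω')
    (h1 : HasSum (fun y : {y : EuclideanSpace ℝ (Fin 3) // y ∈ ω ∧ y ≠ x} =>
      (deriv lennardJones (dist x y) / dist x y) • (x - (y : EuclideanSpace ℝ (Fin 3)))) 0)
    (h2 : HasSum (fun y : {y : EuclideanSpace ℝ (Fin 3) // y ∈ ω' ∧ y ≠ x} =>
      (deriv lennardJones (dist x y) / dist x y) • (x - (y : EuclideanSpace ℝ (Fin 3)))) 0) :
    (∑' y : {y : EuclideanSpace ℝ (Fin 3) // y ∈ ω ∧ y ∉ ω'},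
        (deriv lennardJones (dist x y) / dist x y) • (x - (y : EuclideanSpace ℝ (Fin 3)))) -
      (∑' y : {y : EuclideanSpace ℝ (Fin 3) // y ∈ ω' ∧ y ∉ ω},
        (deriv lennardJones (dist x y) / dist x y) • (x - (y : EuclideanSpace ℝ (Fin 3)))) = 0 := by
  classical
  set F : EuclideanSpace ℝ (Fin 3) → EuclideanSpace ℝ (Fin 3) := fun y =>
    (deriv lennardJones (dist x y) / dist x y) • (x - y) with hF
  set S₁ : Set (EuclideanSpace ℝ (Fin 3)) := {y | y ∈ ω ∧ y ≠ x} with hS₁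
  set S₂ : Set (EuclideanSpace ℝ (Fin 3)) := {y | y ∈ ω' ∧ y ≠ x} with hS₂
  set D₁ : Set (EuclideanSpace ℝ (Fin 3)) := {y | y ∈ ω ∧ y ∉ ω'} with hD₁
  set D₂ : Set (EuclideanSpace ℝ (Fin 3)) := {y | y ∈ ω' ∧ y ∉ ω} with hD₂
  have h1' : HasSum (S₁.indicator F) 0 := (hasSum_subtype_iff_indicator (s := S₁) (f := F)).1 h1
  have h2' : HasSum (S₂.indicator F) 0 := (hasSum_subtype_iff_indicator (s := S₂) (f := F)).1 h2
  -- the one-sided families are summable: their points are at distance `≥ δ` from `x`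
  have hcl₁ : ∀ y : D₁, δ ≤ dist (y : EuclideanSpace ℝ (Fin 3)) x := by
    intro y
    have hyx : (y : EuclideanSpace ℝ (Fin 3)) ≠ x := fun h => y.2.2 (h ▸ hx')
    exact hsep _ y.2.1 _ hx hyx
  have hcl₂ : ∀ y : D₂, δ ≤ dist (y : EuclideanSpace ℝ (Fin 3)) x := by
    intro y
    have hyx : (y : EuclideanSpace ℝ (Fin 3)) ≠ x := fun h => y.2.2 (h ▸ hx)
    exact hsep' _ y.2.1 _ hx' hyx
  have hs₁ : Summable (fun y : D₁ => F y) :=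
    (hbl_summable_norm_ljForce_of_clear hδ hδ hsep (fun y : D₁ => (y : EuclideanSpace ℝ (Fin 3)))
      Subtype.val_injective (fun y => y.2.1) hcl₁).of_norm
  have hs₂ : Summable (fun y : D₂ => F y) :=
    (hbl_summable_norm_ljForce_of_clear hδ hδ hsep' (fun y : D₂ => (y : EuclideanSpace ℝ (Fin 3)))
      Subtype.val_injective (fun y => y.2.1) hcl₂).of_norm
  have hP : HasSum (D₁.indicator F) (∑' y : D₁, F y) :=
    (hasSum_subtype_iff_indicator (s := D₁) (f := F)).1 hs₁.hasSum
  have hM : HasSum (D₂.indicator F) (∑' y : D₂, F y) :=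
    (hasSum_subtype_iff_indicator (s := D₂) (f := F)).1 hs₂.hasSum
  -- pointwise identity of the two signed indicator combinations
  have hpt : (fun y => S₁.indicator F y - S₂.indicator F y) =
      fun y => D₁.indicator F y - D₂.indicator F y := by
    funext y
    by_cases hyx : y = x
    · subst hyx
      simp [hS₁, hS₂, hD₁, hD₂, Set.indicator, hx, hx']
    · by_cases hyω : y ∈ ω <;> by_cases hyω' : y ∈ ω' <;>
        simp [hS₁, hS₂, hD₁, hD₂, Set.indicator, hyω, hyω', hyx]
  have hA : HasSum (fun y => S₁.indicator F y - S₂.indicator F y) (0 - 0) := h1'.sub h2'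
  rw [hpt, sub_zero] at hA
  have hB : HasSum (fun y => D₁.indicator F y - D₂.indicator F y)
      ((∑' y : D₁, F y) - ∑' y : D₂, F y) := hP.sub hM
  exact (hB.unique hA)

/-- **`UCContinuum` (two separated sets whose difference field vanishes on an open set coincide).**
Let `ω, ω' ⊂ ℝ³` be `δ`-separated. If the signed Lennard-Jones force field of their symmetric
difference (`+` on `ω ∖ ω'`, `−` on `ω' ∖ ω`) vanishes on a non-empty open set `U₀` avoiding
`ω ∆ ω'`, then `ω = ω'` (`hbl_sources_empty_of_field_eqOn_open`). No balance, density or finite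
local complexity hypothesis is needed for this half of the crux. [folklore] -/
theorem hbl_eq_of_diffField_eqOn_open {ω ω' : Set (EuclideanSpace ℝ (Fin 3))} {δ : ℝ}
    (hδ : 0 < δ)
    (hsep : ∀ a ∈ ω, ∀ b ∈ ω, a ≠ b → δ ≤ dist a b)
    (hsep' : ∀ a ∈ ω', ∀ b ∈ ω', a ≠ b → δ ≤ dist a b)
    {U₀ : Set (EuclideanSpace ℝ (Fin 3))} (hU₀ : IsOpen U₀) (hne : U₀.Nonempty)
    (hU₁ : ∀ z ∈ U₀, ¬ (z ∈ ω ∧ z ∉ ω')) (hU₂ : ∀ z ∈ U₀, ¬ (z ∈ ω' ∧ z ∉ ω))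
    (hΦ : ∀ z ∈ U₀,
      (∑' y : {y : EuclideanSpace ℝ (Fin 3) // y ∈ ω ∧ y ∉ ω'},
          (deriv lennardJones (dist z y) / dist z y) • (z - (y : EuclideanSpace ℝ (Fin 3)))) -
        (∑' y : {y : EuclideanSpace ℝ (Fin 3) // y ∈ ω' ∧ y ∉ ω},
          (deriv lennardJones (dist z y) / dist z y) • (z - (y : EuclideanSpace ℝ (Fin 3)))) = 0) :
    ω = ω' := by
  have h := hbl_sources_empty_of_field_eqOn_open
    (Xp := {y : EuclideanSpace ℝ (Fin 3) | y ∈ ω ∧ y ∉ ω'})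
    (Xm := {y : EuclideanSpace ℝ (Fin 3) | y ∈ ω' ∧ y ∉ ω}) hδ
    (fun a ha b hb hab => hsep a ha.1 b hb.1 hab) (fun a ha b hb hab => hsep' a ha.1 b hb.1 hab)
    (Set.disjoint_left.2 fun y hy hy' => hy.2 hy'.1) hU₀ hne
    (fun z hz hmem => hmem.elim (hU₁ z hz) (hU₂ z hz)) hΦ
  obtain ⟨hP, hM⟩ := h
  ext y
  constructor
  · intro hy
    by_contra hy'
    have : y ∈ ({y : EuclideanSpace ℝ (Fin 3) | y ∈ ω ∧ y ∉ ω'} : Set (EuclideanSpace ℝ (Fin 3))) :=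
      ⟨hy, hy'⟩
    rw [hP] at this
    exact this
  · intro hy'
    by_contra hy
    have : y ∈ ({y : EuclideanSpace ℝ (Fin 3) | y ∈ ω' ∧ y ∉ ω} : Set (EuclideanSpace ℝ (Fin 3))) :=
      ⟨hy', hy⟩
    rw [hM] at this
    exact this

/-- **The input of `UCDiscrete`.** If the `δ`-separated sets `ω, ω'` are both in exact Lennard-Jones
force balance and agree on the open half-space `{z | ⟪z, u⟫ < a}`, then the signed field of their
symmetric difference vanishes at every point of `ω` in that half-space. [folklore] -/
theorem hbl_diffField_eq_zero_on_halfSpace {ω ω' : Set (EuclideanSpace ℝ (Fin 3))} {δ : ℝ}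
    (hδ : 0 < δ)
    (hsep : ∀ a ∈ ω, ∀ b ∈ ω, a ≠ b → δ ≤ dist a b)
    (hsep' : ∀ a ∈ ω', ∀ b ∈ ω', a ≠ b → δ ≤ dist a b)
    (hbal : ∀ x ∈ ω, HasSum (fun y : {y : EuclideanSpace ℝ (Fin 3) // y ∈ ω ∧ y ≠ x} =>
      (deriv lennardJones (dist x y) / dist x y) • (x - (y : EuclideanSpace ℝ (Fin 3)))) 0)
    (hbal' : ∀ x ∈ ω', HasSum (fun y : {y : EuclideanSpace ℝ (Fin 3) // y ∈ ω' ∧ y ≠ x} =>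
      (deriv lennardJones (dist x y) / dist x y) • (x - (y : EuclideanSpace ℝ (Fin 3)))) 0)
    {u : EuclideanSpace ℝ (Fin 3)} {a : ℝ}
    (hagree : ∀ z : EuclideanSpace ℝ (Fin 3), ⟪z, u⟫_ℝ < a → (z ∈ ω ↔ z ∈ ω')) :
    ∀ x ∈ ω, ⟪x, u⟫_ℝ < a →
      (∑' y : {y : EuclideanSpace ℝ (Fin 3) // y ∈ ω ∧ y ∉ ω'},
          (deriv lennardJones (dist x y) / dist x y) • (x - (y : EuclideanSpace ℝ (Fin 3)))) -
        (∑' y : {y : EuclideanSpace ℝ (Fin 3) // y ∈ ω' ∧ y ∉ ω},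
          (deriv lennardJones (dist x y) / dist x y) • (x - (y : EuclideanSpace ℝ (Fin 3)))) = 0 := by
  intro x hx hxa
  have hx' : x ∈ ω' := (hagree x hxa).1 hx
  exact hbl_diffField_eq_zero_of_balanced hδ hsep hsep' hx hx' (hbal x hx) (hbal' x hx')

/-- **`UCDiscrete → HalfSpaceUniqueContinuation`.** The crux `HalfSpaceUniqueContinuation` (item
stmt-AtomisticToContinuum-6075, equivalent to `FLCEquilibriumPeriodic`, item 6079) follows from its
«discrete-to-continuum» core: under the hypotheses of the crux, the signed Lennard-Jones field of
`ω ∆ ω'` vanishes on SOME non-empty open subset of the open half-space `{z | ⟪z, u⟫ < a}`. Indeed the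
hull elements are `δ`-separated (`hbl_hull_separated`), the open set avoids `ω ∆ ω'` (which lies in
the closed complementary half-space), and `hbl_eq_of_diffField_eqOn_open` applies. The field is known
to vanish at the relatively dense set of points of `ω` in the half-space
(`hbl_diffField_eq_zero_on_halfSpace` with `hbl_hull_balanced`); upgrading this to an open set is the
analytic content of the crux. [folklore] -/
theorem halfSpaceUniqueContinuation_of_open_vanishing
    (H : ∀ (Λ : Set (EuclideanSpace ℝ (Fin 3))) (δ r : ℝ), 0 < δ → 0 < r →
      (∀ x ∈ Λ, ∀ y ∈ Λ, x ≠ y → δ ≤ dist x y) →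
      (∀ c : EuclideanSpace ℝ (Fin 3), ∃ y ∈ Λ, dist y c ≤ r) →
      (∀ R : ℝ, Set.Finite {S : Set (EuclideanSpace ℝ (Fin 3)) |
        ∃ x ∈ Λ, S = {v : EuclideanSpace ℝ (Fin 3) | x + v ∈ Λ ∧ ‖v‖ ≤ R}}) →
      (∀ x ∈ Λ, HasSum (fun y : {y : EuclideanSpace ℝ (Fin 3) // y ∈ Λ ∧ y ≠ x} =>
        (deriv lennardJones (dist x (y : EuclideanSpace ℝ (Fin 3))) /
          dist x (y : EuclideanSpace ℝ (Fin 3))) • (x - (y : EuclideanSpace ℝ (Fin 3)))) 0) →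
      ∀ ω ω' : Set (EuclideanSpace ℝ (Fin 3)),
      (∀ R : ℝ, ∃ v : EuclideanSpace ℝ (Fin 3),
        {z : EuclideanSpace ℝ (Fin 3) | z ∈ ω ∧ ‖z‖ ≤ R} =
          {z : EuclideanSpace ℝ (Fin 3) | z + v ∈ Λ ∧ ‖z‖ ≤ R}) →
      (∀ R : ℝ, ∃ v : EuclideanSpace ℝ (Fin 3),
        {z : EuclideanSpace ℝ (Fin 3) | z ∈ ω' ∧ ‖z‖ ≤ R} =
          {z : EuclideanSpace ℝ (Fin 3) | z + v ∈ Λ ∧ ‖z‖ ≤ R}) →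
      ∀ (u : EuclideanSpace ℝ (Fin 3)) (a : ℝ), u ≠ 0 →
      (∀ z : EuclideanSpace ℝ (Fin 3), inner ℝ z u < a → (z ∈ ω ↔ z ∈ ω')) →
      ∃ U₀ : Set (EuclideanSpace ℝ (Fin 3)), IsOpen U₀ ∧ U₀.Nonempty ∧
        (∀ z ∈ U₀, inner ℝ z u < a) ∧
        ∀ z ∈ U₀,
          (∑' y : {y : EuclideanSpace ℝ (Fin 3) // y ∈ ω ∧ y ∉ ω'},
              (deriv lennardJones (dist z y) / dist z y) • (z - (y : EuclideanSpace ℝ (Fin 3)))) -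
            (∑' y : {y : EuclideanSpace ℝ (Fin 3) // y ∈ ω' ∧ y ∉ ω},
              (deriv lennardJones (dist z y) / dist z y) • (z - (y : EuclideanSpace ℝ (Fin 3)))) = 0) :
    HalfSpaceUniqueContinuation := by
  intro Λ δ r hδ hr hsep hden hFLC hbal ω ω' hω hω' u a hu hagree
  obtain ⟨U₀, hU₀, hne, hUhalf, hΦ⟩ :=
    H Λ δ r hδ hr hsep hden hFLC hbal ω ω' hω hω' u a hu hagree
  refine hbl_eq_of_diffField_eqOn_open hδ (hbl_hull_separated hsep hω) (hbl_hull_separated hsep hω')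
    hU₀ hne ?_ ?_ hΦ
  · rintro z hz ⟨hzω, hzω'⟩
    exact hzω' ((hagree z (hUhalf z hz)).1 hzω)
  · rintro z hz ⟨hzω', hzω⟩
    exact hzω ((hagree z (hUhalf z hz)).2 hzω')

end Summit.AtomisticToContinuum.Crystallization.Theorems

end
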